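import Summits.BirchSwinnertonDyer.BirchSwinnertonDyer.Theorems.GoldfeldAllTwistsTwoConverseTwinAdditiveInertTwistDescent
import Literature.NumberTheory.EllipticCurves.TwoIsogenyDescentOddMultipleProofs
import Literature.NumberTheory.EllipticCurves.VariableChangePoints
import Literature.NumberTheory.EllipticCurves.RationalPointInfiniteOrderCriteria
import Literature.NumberTheory.EllipticCurves.LeadingTermHeegnerProofs
import HarnessLib

set_option linter.dupNamespace false -- `…BirchSwinnertonDyer.BirchSwinnertonDyer…` is the cell's namespace (D-0017)
set_option autoImplicit false

/-!
# LINE B49 — the FIXED partner curves of the genus mechanism, I: `49a1^{(−1)}` (`N = 784`) has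
# rank EXACTLY `1`, `Ш[2] = 0`, and `(0, 1)` is an ODD multiple of a generator (input G3 of Theorem A)

Cell `bsd-goldfeld`, seat `bsd-goldfeld-s1p-c301` (prover, gen 6); TARGET v5.2 §2 c301 (f) as re-scoped
by planner g14 ruling (xvi) («G3-reduced»). Support for item `stmt-BirchSwinnertonDyer-19140` (crux
twin″ `Theses.GoldfeldAllTwistsTwoConverse.BSDTwoCMSevenAdditiveRankOne`; joint with item 20044 K12₂″)
of `route-BirchSwinnertonDyer-GoldfeldAllTwistsTwoConverse`. HONEST FRAMING: theorems about one
explicit elliptic curve over `ℚ`; BSD is not proved by any of this and both cruxes stay OPEN. Not in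
the Theses import cone (ruling (xii)).

WHY. The genus mechanism behind LINE B49 (memo `HOME/B49-GENUS.md`, seat s1p-c3 gen 5; kernel descent
`…TwinGenusOddMultiple.lean`, seat s1p-c3 gen 6, named input `X049GenusPointOddMultiple`) reads the
Heegner point `y_K ∈ X₀(49)(ℚ(√−q))` against its twist `y_χ` by the genus character, which lives in
`X₀(49)(ℚ(i))⁻ ≅ 49a1^{(−1)}(ℚ)` — a FIXED rank-one curve — together with the point `g' = (0, i)`
of `X₀(49)` over the genus field. Theorem A of the memo («`μ • y_χ − λ • g'` torsion, `λ` odd»)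
consumes, about the fixed curve: (a) `rank 49a1^{(−1)}(ℚ) = 1`; (b) the point `g₇₈₄ = (0, 1)` of
`cm7^{(−1)} = [0, 3/4, 0, −2, 1]` — the image of `(0, i)` under the twist substitution
`(X, Y) = (t²x, t³(y + x/2))`, `t = i` — is NOT in `2E + tors`, so its coordinate along a
generator is ODD; (c) `Ш[2] = 0` (with finiteness: `#Ш` odd). This file proves (a)–(c) in the
kernel, UNCONDITIONALLY; the companions `…TwinGenusDescentNegTwo.lean` (`49a1^{(−2)}`, family F2),
`…TwinGenusDescentMinimal.lean` (globally minimal models, conductors, the bsd.S31 hook) and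
`…TwinGenusDescentRankZero.lean` (`49a1^{(2)}`, family F3) complete the fixed-curve inputs.

HOW. Upper bound: seat c301 gen 2's complete `2`-isogeny descent `rank_le_one_and_sha_two_inertTwist`
(`S(−21m,112m²) ⊆ {1,2,7,14}`, `S(42m,−7m²) ⊆ {1,−7}`) at `m = 1`: `rank ≤ 1` and
`rank = 1 ⇒ Ш[2] = 0` for every `ℚ`-model. Lower bound and (b): on the two-torsion model
`y² = x³ − 21x² + 112x = (1/2, −2, 0, 0) • cm7^{(−1)}` the point is `(8, 8)` and Silverman–Tate's
homomorphism `α = xSqClass` takes the value `[2] ∉ {1, [7]}` there, while `a² − 4b = −7` and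
`b ~ 7` are non-squares; the odd-multiple descent lemma of seat c3 gen 6
(`ne_two_zsmul_add_of_oddMultiple`) gives «`(0,1) ∉ 2E(F) + E(F)_tors`» over EVERY field `F ⊇ ℚ`
in which `−7, 7, 2, 14` are not squares (`ℚ`, `ℚ(√−q)`, the genus field `ℚ(i, √q)` for an odd
prime `q ≠ 7` — seat c3's `not_isSquare_genusField`), in particular infinite order and `rank ≥ 1`
(Mordell–Weil, `one_le_mordellWeilRank_of_not_isOfFinAddOrder_rat`). §0: in rank one,
commensurability (`exists_smul_eq_smul_of_finrank_eq_one`) plus a `2`-adic descent on the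
coefficient turn «`g ∉ 2E + tors`» into «every `P` satisfies `n • P − a • g ∈ tors` with `n` ODD»,
and along any Mordell–Weil basis `P₀` (`IsMordellWeilBasis`), `g ≡ k • P₀ (mod tors)` with `k` ODD.

CONTENTS. §0 abstract: `exists_odd_zsmul_sub_zsmul_isOfFinAddOrder`,
`exists_sub_zsmul_isOfFinAddOrder_of_isMordellWeilBasis`, `odd_of_sub_zsmul_isOfFinAddOrder`, the
`α`-criterion `some_ne_two_zsmul_add_of_not_isSquare` and its transport `ne_two_zsmul_add_of_addEquiv`.
§1: the model lemmas, `zeroOne_ne_two_zsmul_add_of_twoTorsionChange` (any field), the `ℚ`-versions,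
**`mordellWeilRank_cm7_quadraticTwist_neg_one` (`= 1`)**, **`forall_mem_sha_two_cm7_quadraticTwist_neg_one`**,
`exists_odd_zsmul_sub_zsmul_zeroOne_…`, `exists_odd_zeroOne_sub_zsmul_basis_…`. Over `ℚ` the point
group is elaborated with `ℚ`'s decidable equality while generic statements (`mordellWeilRank`,
`IsMordellWeilBasis`) carry the classical one; the instances are subsingletons (`convert`).

References: J. H. Silverman, J. T. Tate, *Rational Points on Elliptic Curves* (2015) §3.5
[SilvermanTate2015]; J. H. Silverman, *AEC* (2009) III.1, VIII.6.7, X.4.2, X.4.9 [SilvermanAEC2009];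
J. E. Cremona, *Algorithms for Modular Elliptic Curves* (1997) Table 1 (curve 784) [CremonaAlgorithms1997];
B. Gross, *Heegner points on X₀(N)* (1984) §§4–5 [Gross1984]; Y. Tian, Camb. J. Math. 2 (2014) (1.3) [Tian2014].
-/

noncomputable section

open scoped Classical

open WeierstrassCurve Literature.NumberTheory.EllipticCurves

namespace Summit.BirchSwinnertonDyer.BirchSwinnertonDyer.Theorems.GoldfeldGoodTwists

/-! ## §0 Odd index from rank one and non-halvability (abstract) -/

/-- `−x` has finite order iff `x` does (restated through `AddCommGroup.torsion`). [folklore] -/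
theorem isOfFinAddOrder_neg_iff' {M : Type*} [AddCommGroup M] {x : M} :
    IsOfFinAddOrder (-x) ↔ IsOfFinAddOrder x := by
  rw [← AddCommGroup.mem_torsion, ← AddCommGroup.mem_torsion]
  exact neg_mem_iff

/-- **Odd index from rank one and non-halvability.** In a finitely generated abelian group `M` of
rank `1`, let `g` have infinite order and `g ∉ 2M + M_tors`. Then every `P ∈ M` satisfies
`n • P − a • g ∈ M_tors` for some ODD `n` and some `a ∈ ℤ` (i.e. the index of `ℤg + M_tors` in
`M` is odd). Commensurability in rank one (`exists_smul_eq_smul_of_finrank_eq_one`) and a `2`-adic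
descent on the coefficient: if `2^{k+1} m • P − a • g` is torsion then `a` is even (else
`g ∈ 2M + tors`), and halving keeps a torsion difference. [folklore] -/
theorem exists_odd_zsmul_sub_zsmul_isOfFinAddOrder {M : Type*} [AddCommGroup M] [Module.Finite ℤ M]
    (h1 : Module.finrank ℤ M = 1) {g : M} (hg : ¬ IsOfFinAddOrder g)
    (hg2 : ∀ R t : M, IsOfFinAddOrder t → g ≠ (2 : ℤ) • R + t) (P : M) :
    ∃ n a : ℤ, Odd n ∧ IsOfFinAddOrder (n • P - a • g) := by
  -- the `2`-adic descent on the coefficient of `P`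
  have step : ∀ (k : ℕ) (m : ℕ) (a : ℤ), Odd m → IsOfFinAddOrder (((2 ^ k * m : ℕ) : ℤ) • P - a • g) →
      ∃ a' : ℤ, IsOfFinAddOrder ((m : ℤ) • P - a' • g) := by
    intro k
    induction k with
    | zero => intro m a _ h; exact ⟨a, by simpa using h⟩
    | succ k ih =>
      intro m a hm h
      -- `a` is even
      obtain ⟨a', rfl⟩ : Even a := by
        by_contra ha
        rw [Int.not_even_iff_odd] at ha
        obtain ⟨c, hc⟩ := ha
        -- `a • g = 2^{k+1} m • P - t`, so `g = 2 • (2^k m • P - c • g) + (-t)`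
        set t := ((2 ^ (k + 1) * m : ℕ) : ℤ) • P - a • g with ht
        refine hg2 (((2 ^ k * m : ℕ) : ℤ) • P - c • g) (-t) ((isOfFinAddOrder_neg_iff').mpr h) ?_
        rw [ht, hc]
        push_cast
        module
      refine ih m a' hm (isOfFinAddOrder_of_zsmul (n := 2) two_ne_zero ?_)
      have e : (2 : ℤ) • ((((2 ^ k * m : ℕ) : ℤ)) • P - a' • g) =
          ((2 ^ (k + 1) * m : ℕ) : ℤ) • P - (a' + a') • g := by
        push_cast
        module
      rwa [e]
  by_cases hP : IsOfFinAddOrder P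
  · exact ⟨1, 0, odd_one, by simpa using hP⟩
  obtain ⟨b, a, hb, -, hba⟩ := exists_smul_eq_smul_of_finrank_eq_one h1 hP hg
  -- `b • P = a • g`; write `|b| = 2^k m` with `m` odd
  obtain ⟨k, m, hm, hkm⟩ := Nat.exists_eq_two_pow_mul_odd (Int.natAbs_ne_zero.mpr hb)
  have hodd : Odd (m : ℤ) := by exact_mod_cast hm
  rcases Int.natAbs_eq b with hb' | hb'
  · obtain ⟨a', ha'⟩ := step k m a hm (by rw [← hkm, ← hb', hba, sub_self]; exact IsOfFinAddOrder.zero)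
    exact ⟨m, a', hodd, ha'⟩
  · obtain ⟨a', ha'⟩ := step k m (-a) hm (by
      rw [← hkm, show ((b.natAbs : ℕ) : ℤ) = -b by omega, neg_smul, hba, neg_smul, sub_neg_eq_add,
        neg_add_cancel]
      exact IsOfFinAddOrder.zero)
    exact ⟨m, a', hodd, ha'⟩


/-- **Coordinates along a rank-one Mordell–Weil basis.** If `P : Fin 1 → E(K)` is a Mordell–Weil
basis, every `Q ∈ E(K)` is `a • P 0` modulo torsion. [cite: SilvermanAEC2009, Ch. VIII intro (p. 207)] -/
theorem exists_sub_zsmul_isOfFinAddOrder_of_isMordellWeilBasis {K : Type*} [Field K]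
    {W : WeierstrassCurve K} {P : Fin 1 → W.toAffine.Point} (hP : IsMordellWeilBasis P)
    (Q : W.toAffine.Point) : ∃ a : ℤ, IsOfFinAddOrder (Q - a • P 0) := by
  have hmem : (QuotientAddGroup.mk Q : mordellWeilModTorsion W) ∈
      Submodule.span ℤ (Set.range (QuotientAddGroup.mk ∘ P : Fin 1 → mordellWeilModTorsion W)) := by
    rw [hP.2]; trivial
  have hrange : Set.range (QuotientAddGroup.mk ∘ P : Fin 1 → mordellWeilModTorsion W) =
      {(QuotientAddGroup.mk (P 0) : mordellWeilModTorsion W)} := by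
    ext x
    simp only [Set.mem_range, Function.comp_apply, Set.mem_singleton_iff]
    constructor
    · rintro ⟨i, rfl⟩; rw [Subsingleton.elim i 0]
    · rintro rfl; exact ⟨0, rfl⟩
  rw [hrange, Submodule.mem_span_singleton] at hmem
  obtain ⟨a, ha⟩ := hmem
  refine ⟨a, ?_⟩
  rw [← AddCommGroup.mem_torsion, ← QuotientAddGroup.eq_zero_iff, QuotientAddGroup.mk_sub,
    QuotientAddGroup.mk_zsmul, ← ha, sub_self]

/-- **A non-halvable point has ODD coordinate along a rank-one Mordell–Weil basis**: if
`g ∉ 2E(K) + E(K)_tors` and `g − a • P 0` is torsion then `a` is odd. [folklore] -/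
theorem odd_of_sub_zsmul_isOfFinAddOrder {M : Type*} [AddCommGroup M] {g P₀ : M}
    (hg2 : ∀ R t : M, IsOfFinAddOrder t → g ≠ (2 : ℤ) • R + t) {a : ℤ}
    (ha : IsOfFinAddOrder (g - a • P₀)) : Odd a := by
  by_contra hodd
  obtain ⟨c, rfl⟩ := Int.not_odd_iff_even.mp hodd
  refine hg2 (c • P₀) (g - (c + c) • P₀) ha ?_
  module

/-! ### The `α`-criterion for a single point, and its transport along a change of variables -/

section Alpha

variable {F : Type*} [Field F]

/-- **A point with `α(g) ∉ {1, [b]}` is not in `2E(F) + E(F)_tors`** on `E : y² = x³ + ax² + bx`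
with `a² − 4b`, `b` non-squares: the odd-multiple descent lemma of `TwoIsogenyDescentOddMultipleProofs`
with `y = y' = g`, `Z = O`, `μ = λ = 1`, the `α`-values read off the coordinates (`x(g) ≠ 0`,
`x(g)` and `x(g)·b` non-squares). [cite: SilvermanTate2015, §3.5] -/
theorem some_ne_two_zsmul_add_of_not_isSquare (V : WeierstrassCurve F) [V.IsTwoTorsionNF]
    [V.IsElliptic] (hD : ¬ IsSquare (V.a₂ ^ 2 - 4 * V.a₄)) (hb : ¬ IsSquare V.a₄) {x y : F}
    (h : V.toAffine.Nonsingular x y) (hx : x ≠ 0) (h₁ : ¬ IsSquare x) (h₂ : ¬ IsSquare (x * V.a₄))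
    (R t : V.toAffine.Point) (ht : IsOfFinAddOrder t) : Affine.Point.some x y h ≠ (2 : ℤ) • R + t := by
  obtain ⟨hg₁, hg₂⟩ := V.xSqClass_ne_one_and_ne_of_not_isSquare h hx h₁ h₂
  refine V.ne_two_zsmul_add_of_oddMultiple hD hb odd_one (y := .some x y h) (y' := .some x y h)
    (Z := 0) (μ := 1) ?_ ?_ hg₁ hg₂ R t ht
  · rw [sub_self, smul_zero, sub_zero]; exact IsOfFinAddOrder.zero
  · rw [sub_self]; exact IsOfFinAddOrder.zero

/-- … in particular such a point has infinite order. [cite: SilvermanTate2015, §3.5] -/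
theorem not_isOfFinAddOrder_some_of_not_isSquare (V : WeierstrassCurve F) [V.IsTwoTorsionNF]
    [V.IsElliptic] (hD : ¬ IsSquare (V.a₂ ^ 2 - 4 * V.a₄)) (hb : ¬ IsSquare V.a₄) {x y : F}
    (h : V.toAffine.Nonsingular x y) (hx : x ≠ 0) (h₁ : ¬ IsSquare x) (h₂ : ¬ IsSquare (x * V.a₄)) :
    ¬ IsOfFinAddOrder (Affine.Point.some x y h) := fun hfin =>
  some_ne_two_zsmul_add_of_not_isSquare V hD hb h hx h₁ h₂ 0 _ hfin (by rw [smul_zero, zero_add])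

/-- Transport of «`P ∉ 2E(F) + E(F)_tors`» along an additive isomorphism (e.g. the point map of a
change of variables). [folklore] -/
theorem ne_two_zsmul_add_of_addEquiv {A B : Type*} [AddCommGroup A] [AddCommGroup B] (e : A ≃+ B)
    {P : A} (hP : ∀ R t : B, IsOfFinAddOrder t → e P ≠ (2 : ℤ) • R + t)
    (R t : A) (ht : IsOfFinAddOrder t) : P ≠ (2 : ℤ) • R + t := by
  intro h
  refine hP (e R) (e t) (e.toAddMonoidHom.isOfFinAddOrder ht) ?_
  rw [h, map_add, map_zsmul]

end Alpha
/-! ## §1 `49a1^{(−1)}` (`N = 784`): two-torsion model, the point `(0, 1)`, rank `1`, `Ш[2] = 0` -/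

section NegOne

/-- `cm7^{(−1)} = [0, 3/4, 0, −2, 1]` is elliptic. [folklore] -/
theorem isElliptic_cm7_quadraticTwist_neg_one : (cm7.quadraticTwist (-1)).IsElliptic :=
  cm7.isElliptic_quadraticTwist (by norm_num)

/-- The point `(0, 1)` lies on `cm7^{(−1)} : y² = x³ + (3/4)x² − 2x + 1` (the image of
`(0, i) ∈ X₀(49)(ℚ(i))` under the twist substitution). [folklore] -/
theorem nonsingular_cm7_quadraticTwist_neg_one_zero_one :
    (cm7.quadraticTwist (-1)).toAffine.Nonsingular 0 1 := by
  haveI := isElliptic_cm7_quadraticTwist_neg_one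
  refine (Affine.equation_iff_nonsingular).mp ?_
  rw [Affine.equation_iff']
  simp [quadraticTwist, b₂, b₄, b₆]
  norm_num

/-- Over any field `F` of characteristic `0`: the change of variables `(u, r, s, t) = (1/2, −2, 0, 0)`
takes `cm7^{(−1)} ⊗ F` to the two-torsion normal form `y² = x³ − 21x² + 112x`.
[cite: SilvermanAEC2009, III.1 Table 3.1] -/
theorem twoTorsionChange_smul_cm7_quadraticTwist_neg_one (F : Type*) [Field F] [CharZero F] :
    (⟨(Units.mk0 (2 : F) two_ne_zero)⁻¹, -2, 0, 0⟩ : VariableChange F) •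
        (cm7.quadraticTwist (-1)).baseChange F = ⟨0, -21, 0, 112, 0⟩ := by
  ext <;> simp [baseChange, quadraticTwist, b₂, b₄, b₆, variableChange_a₁, variableChange_a₂,
    variableChange_a₃, variableChange_a₄, variableChange_a₆] <;> norm_num


/-- A square `r² = c·k²` with `k ≠ 0` makes `c` a square. [folklore] -/
theorem isSquare_of_sq_mul {F : Type*} [Field F] {c k r : F} (hk : k ≠ 0)
    (h : r * r = c * (k * k)) : IsSquare c :=
  ⟨r / k, by rw [div_mul_div_comm, h, mul_div_cancel_right₀ _ (mul_ne_zero hk hk)]⟩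

variable {F : Type*} [Field F] [CharZero F]

/-- **The point `(0, 1)` of `cm7^{(−1)}` is not in `2E(F) + E(F)_tors`** over any field `F` of
characteristic `0` in which `−7, 7, 2, 14` are not squares (e.g. `ℚ`, `ℚ(√−q)`, the genus field
`ℚ(i, √q)` for an odd prime `q ≠ 7`), for any model `E/F` carried by `(u, r, s, t) = (1/2, −2, 0, 0)`
to `y² = x³ − 21x² + 112x` (there the point is `(8, 8)`, `α = [8] = [2] ∉ {1, [112] = [7]}`).
[cite: SilvermanTate2015, §3.5] -/
theorem zeroOne_ne_two_zsmul_add_of_twoTorsionChange {E : WeierstrassCurve F} [E.IsElliptic]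
    (hE : (⟨(Units.mk0 (2 : F) two_ne_zero)⁻¹, -2, 0, 0⟩ : VariableChange F) • E = ⟨0, -21, 0, 112, 0⟩)
    (h7 : ¬ IsSquare (-7 : F)) (h7' : ¬ IsSquare (7 : F)) (h2 : ¬ IsSquare (2 : F))
    (h14 : ¬ IsSquare (14 : F)) (h01 : E.toAffine.Nonsingular 0 1)
    (R t : E.toAffine.Point) (ht : IsOfFinAddOrder t) : Affine.Point.some 0 1 h01 ≠ (2 : ℤ) • R + t := by
  let C : VariableChange F := ⟨(Units.mk0 (2 : F) two_ne_zero)⁻¹, -2, 0, 0⟩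
  have hVeq : C • E = ⟨0, -21, 0, 112, 0⟩ := hE
  haveI : (C • E).IsTwoTorsionNF := by rw [hVeq]; infer_instance
  have ha₂ : (C • E).a₂ = -21 := by rw [hVeq]
  have ha₄ : (C • E).a₄ = 112 := by rw [hVeq]
  have hD : ¬ IsSquare ((C • E).a₂ ^ 2 - 4 * (C • E).a₄) := by
    rw [ha₂, ha₄, show ((-21 : F) ^ 2 - 4 * 112) = -7 by norm_num]; exact h7
  have hb : ¬ IsSquare (C • E).a₄ := by
    rw [ha₄]; rintro ⟨r, hr⟩
    exact h7' (isSquare_of_sq_mul (k := 4) (by norm_num) (by linear_combination hr.symm))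
  have hx : C.toX 0 = 8 := by
    rw [VariableChange.toX_def]; simp only [C, inv_inv, Units.val_mk0]; norm_num
  have h01' := (VariableChange.nonsingular_iff _ C 0 1).mpr h01
  have hsq1 : ¬ IsSquare (C.toX 0) := by
    rw [hx]; rintro ⟨r, hr⟩
    exact h2 (isSquare_of_sq_mul (k := 2) (by norm_num) (by linear_combination hr.symm))
  have hsq2 : ¬ IsSquare (C.toX 0 * (C • E).a₄) := by
    rw [hx, ha₄]; rintro ⟨r, hr⟩
    exact h14 (isSquare_of_sq_mul (k := 8) (by norm_num) (by linear_combination hr.symm))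
  refine ne_two_zsmul_add_of_addEquiv (VariableChange.pointEquiv _ C) (fun R' t' ht' => ?_) R t ht
  rw [VariableChange.pointEquiv_some]
  exact some_ne_two_zsmul_add_of_not_isSquare _ hD hb h01' (by rw [hx]; norm_num) hsq1 hsq2 R' t' ht'

/-- **`(0, 1) ∈ cm7^{(−1)}(F)` is not in `2·cm7^{(−1)}(F) + tors`**, `F ⊇ ℚ` any field in which
`−7, 7, 2, 14` are not squares. [cite: SilvermanTate2015, §3.5] -/
theorem zeroOne_ne_two_zsmul_add_cm7_quadraticTwist_neg_one (h7 : ¬ IsSquare (-7 : F))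
    (h7' : ¬ IsSquare (7 : F)) (h2 : ¬ IsSquare (2 : F)) (h14 : ¬ IsSquare (14 : F))
    (h01 : ((cm7.quadraticTwist (-1)).baseChange F).toAffine.Nonsingular 0 1)
    (R t : ((cm7.quadraticTwist (-1)).baseChange F).toAffine.Point) (ht : IsOfFinAddOrder t) :
    Affine.Point.some 0 1 h01 ≠ (2 : ℤ) • R + t :=
  haveI := isElliptic_cm7_quadraticTwist_neg_one
  zeroOne_ne_two_zsmul_add_of_twoTorsionChange (twoTorsionChange_smul_cm7_quadraticTwist_neg_one F)
    h7 h7' h2 h14 h01 R t ht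

/-- **… hence `(0, 1) ∈ cm7^{(−1)}(F)` has infinite order** (same fields). [cite: SilvermanTate2015, §3.5] -/
theorem not_isOfFinAddOrder_zeroOne_cm7_quadraticTwist_neg_one (h7 : ¬ IsSquare (-7 : F))
    (h7' : ¬ IsSquare (7 : F)) (h2 : ¬ IsSquare (2 : F)) (h14 : ¬ IsSquare (14 : F))
    (h01 : ((cm7.quadraticTwist (-1)).baseChange F).toAffine.Nonsingular 0 1) :
    ¬ IsOfFinAddOrder (Affine.Point.some 0 1 h01) := fun hfin =>
  zeroOne_ne_two_zsmul_add_cm7_quadraticTwist_neg_one h7 h7' h2 h14 h01 0 _ hfin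
    (by rw [smul_zero, zero_add])

/-! ### Over `ℚ`: rank exactly `1`, `Ш[2] = 0`, odd index -/

/-- `−7, 7, 2, 14` are not squares in `ℚ` (`−7 < 0`; `4 < 7 < 9`, `1 < 2 < 4`, `9 < 14 < 16`). [folklore] -/
theorem not_isSquare_rat_neg7_7_2_14 :
    ¬ IsSquare (-7 : ℚ) ∧ ¬ IsSquare (7 : ℚ) ∧ ¬ IsSquare (2 : ℚ) ∧ ¬ IsSquare (14 : ℚ) := by
  refine ⟨?_, ?_, ?_, ?_⟩
  · rw [show (-7 : ℚ) = ((-7 : ℤ) : ℚ) by norm_num, Rat.isSquare_intCast_iff]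
    rintro ⟨r, hr⟩; nlinarith [mul_self_nonneg r]
  · rw [show (7 : ℚ) = ((7 : ℕ) : ℚ) by norm_num, Rat.isSquare_natCast_iff]
    rintro ⟨r, hr⟩; exact Nat.not_exists_sq (m := 2) (by norm_num) (by norm_num) ⟨r, hr.symm⟩
  · rw [show (2 : ℚ) = ((2 : ℕ) : ℚ) by norm_num, Rat.isSquare_natCast_iff]
    rintro ⟨r, hr⟩; exact Nat.not_exists_sq (m := 1) (by norm_num) (by norm_num) ⟨r, hr.symm⟩
  · rw [show (14 : ℚ) = ((14 : ℕ) : ℚ) by norm_num, Rat.isSquare_natCast_iff]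
    rintro ⟨r, hr⟩; exact Nat.not_exists_sq (m := 3) (by norm_num) (by norm_num) ⟨r, hr.symm⟩

/-- The two-torsion change over `ℚ`: `(1/2, −2, 0, 0) • cm7^{(−1)} = [0, −21, 0, 112, 0]`.
[cite: SilvermanAEC2009, III.1 Table 3.1] -/
theorem twoTorsionChange_smul_cm7_quadraticTwist_neg_one_rat :
    (⟨(Units.mk0 (2 : ℚ) two_ne_zero)⁻¹, -2, 0, 0⟩ : VariableChange ℚ) • cm7.quadraticTwist (-1) =
      ⟨0, -21, 0, 112, 0⟩ := by
  ext <;> simp [quadraticTwist, b₂, b₄, b₆, variableChange_a₁, variableChange_a₂,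
    variableChange_a₃, variableChange_a₄, variableChange_a₆] <;> norm_num

/-- **`g₇₈₄ := (0, 1) ∈ cm7^{(−1)}(ℚ)` is not in `2·cm7^{(−1)}(ℚ) + tors`** — an odd multiple of a
generator modulo torsion once the rank is `1`. (Over `ℚ` the point group is elaborated with the
decidable equality of `ℚ`; the generic statement is transported by `convert`, the `DecidableEq`
instances being subsingletons.) [cite: SilvermanTate2015, §3.5] -/
theorem zeroOne_ne_two_zsmul_add_cm7_quadraticTwist_neg_one_rat
    (R t : (cm7.quadraticTwist (-1)).toAffine.Point) (ht : IsOfFinAddOrder t) :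
    Affine.Point.some 0 1 nonsingular_cm7_quadraticTwist_neg_one_zero_one ≠ (2 : ℤ) • R + t := by
  haveI := isElliptic_cm7_quadraticTwist_neg_one
  have h := zeroOne_ne_two_zsmul_add_of_twoTorsionChange
    twoTorsionChange_smul_cm7_quadraticTwist_neg_one_rat not_isSquare_rat_neg7_7_2_14.1
    not_isSquare_rat_neg7_7_2_14.2.1 not_isSquare_rat_neg7_7_2_14.2.2.1
    not_isSquare_rat_neg7_7_2_14.2.2.2 nonsingular_cm7_quadraticTwist_neg_one_zero_one R t
    (by convert ht)
  convert h

/-- **`(0, 1) ∈ cm7^{(−1)}(ℚ)` has infinite order.** [cite: SilvermanTate2015, §3.5] -/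
theorem not_isOfFinAddOrder_zeroOne_cm7_quadraticTwist_neg_one_rat :
    ¬ IsOfFinAddOrder (Affine.Point.some 0 1 nonsingular_cm7_quadraticTwist_neg_one_zero_one :
      (cm7.quadraticTwist (-1)).toAffine.Point) := by
  intro hfin
  exact zeroOne_ne_two_zsmul_add_cm7_quadraticTwist_neg_one_rat 0 _ hfin (by rw [zsmul_zero, zero_add])

/-- **`rank cm7^{(−1)}(ℚ) ≤ 1`, and `= 1 ⇒ Ш(cm7^{(−1)}/ℚ)[2] = 0`** — the complete `2`-isogeny
descent of seat c301 gen 2 (`rank_le_one_and_sha_two_inertTwist`, `S(−21,112) ⊆ {1,2,7,14}`,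
`S(42,−7) ⊆ {1,−7}`) at `m = 1`. [cite: SilvermanAEC2009, Thm. X.4.2(a), Prop. X.4.9] -/
theorem rank_le_one_and_sha_two_cm7_quadraticTwist_neg_one :
    (cm7.quadraticTwist (-1)).mordellWeilRank ≤ 1 ∧
      ((cm7.quadraticTwist (-1)).mordellWeilRank = 1 →
        ∀ c ∈ (cm7.quadraticTwist (-1)).sha, 2 • c = 0 → c = 0) := by
  haveI := isElliptic_cm7_quadraticTwist_neg_one
  refine rank_le_one_and_sha_two_inertTwist (m := 1) one_pos squarefree_one
    (fun l hl h1 => absurd (Nat.dvd_one.mp h1) hl.ne_one) (cm7.quadraticTwist (-1)) 1 ?_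
  rw [one_smul]; norm_num

/-- **`rank cm7^{(−1)}(ℚ) = 1`** (UNCONDITIONAL: `≤ 1` by the `2`-isogeny descent, `≥ 1` by the
point `(0, 1)` of infinite order and the Mordell–Weil theorem). This is the curve `784` of
Cremona's table (`49a1^{(−1)}`, minimal model `[0,0,0,−35,98]`), the FIXED rank-one partner of the
genus mechanism on the family `49a1^{(−q)}`. [cite: SilvermanAEC2009, Thm. X.4.2(a) and Thm. VIII.6.7] -/
theorem mordellWeilRank_cm7_quadraticTwist_neg_one : (cm7.quadraticTwist (-1)).mordellWeilRank = 1 := by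
  haveI := isElliptic_cm7_quadraticTwist_neg_one
  refine le_antisymm rank_le_one_and_sha_two_cm7_quadraticTwist_neg_one.1 ?_
  refine one_le_mordellWeilRank_of_not_isOfFinAddOrder_rat (cm7.quadraticTwist (-1))
    (P := Affine.Point.some 0 1 nonsingular_cm7_quadraticTwist_neg_one_zero_one) ?_
  convert not_isOfFinAddOrder_zeroOne_cm7_quadraticTwist_neg_one_rat

/-- **`Ш(cm7^{(−1)}/ℚ)[2] = 0`** (UNCONDITIONAL). [cite: SilvermanAEC2009, Thm. X.4.2(a), Prop. X.4.9] -/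
theorem forall_mem_sha_two_cm7_quadraticTwist_neg_one :
    ∀ c ∈ (cm7.quadraticTwist (-1)).sha, 2 • c = 0 → c = 0 :=
  rank_le_one_and_sha_two_cm7_quadraticTwist_neg_one.2 mordellWeilRank_cm7_quadraticTwist_neg_one

/-- **Odd index of `(0, 1)`**: every `P ∈ cm7^{(−1)}(ℚ)` satisfies `n • P − a • (0,1) ∈ tors` for some
ODD `n` and some `a` (rank one, `(0,1) ∉ 2E + tors`, `exists_odd_zsmul_sub_zsmul_isOfFinAddOrder`) —
the shape in which Theorem A of the genus mechanism consumes the fixed curve (`μ • y_χ − λ • g`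
torsion). [cite: SilvermanAEC2009, Thm. VIII.6.7] [cite: SilvermanTate2015, §3.5] -/
theorem exists_odd_zsmul_sub_zsmul_zeroOne_cm7_quadraticTwist_neg_one
    (P : (cm7.quadraticTwist (-1)).toAffine.Point) :
    ∃ n a : ℤ, Odd n ∧ IsOfFinAddOrder
      (n • P - a • Affine.Point.some 0 1 nonsingular_cm7_quadraticTwist_neg_one_zero_one) := by
  haveI := isElliptic_cm7_quadraticTwist_neg_one
  haveI : Module.Finite ℤ (cm7.quadraticTwist (-1)).toAffine.Point := by
    convert (cm7.quadraticTwist (-1)).module_finite_point_holds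
  have h1 : Module.finrank ℤ (cm7.quadraticTwist (-1)).toAffine.Point = 1 := by
    have h := mordellWeilRank_cm7_quadraticTwist_neg_one
    unfold WeierstrassCurve.mordellWeilRank at h
    convert h
  exact exists_odd_zsmul_sub_zsmul_isOfFinAddOrder h1
    not_isOfFinAddOrder_zeroOne_cm7_quadraticTwist_neg_one_rat
    zeroOne_ne_two_zsmul_add_cm7_quadraticTwist_neg_one_rat P

/-- **Along any Mordell–Weil basis `P₀` of `cm7^{(−1)}(ℚ)` (rank one), `(0,1) ≡ k • P₀ (mod tors)`
with `k` ODD** — so `ĥ((0,1)) = k² · Reg(cm7^{(−1)}/ℚ)` with `k` odd in the regulator bookkeeping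
of Theorem A. [cite: SilvermanAEC2009, Ch. VIII intro (p. 207)] [cite: SilvermanTate2015, §3.5] -/
theorem exists_odd_zeroOne_sub_zsmul_basis_cm7_quadraticTwist_neg_one
    {P : Fin 1 → (cm7.quadraticTwist (-1)).toAffine.Point} (hP : IsMordellWeilBasis P) :
    ∃ k : ℤ, Odd k ∧ IsOfFinAddOrder
      (Affine.Point.some 0 1 nonsingular_cm7_quadraticTwist_neg_one_zero_one - k • P 0) := by
  obtain ⟨a, ha⟩ := exists_sub_zsmul_isOfFinAddOrder_of_isMordellWeilBasis hP
    (Affine.Point.some 0 1 nonsingular_cm7_quadraticTwist_neg_one_zero_one)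
  -- `ha` is stated for the generic (classical) point group; re-elaborate it over `ℚ`
  have ha' : IsOfFinAddOrder
      (Affine.Point.some 0 1 nonsingular_cm7_quadraticTwist_neg_one_zero_one - a • P 0) := by
    convert ha
  exact ⟨a, odd_of_sub_zsmul_isOfFinAddOrder zeroOne_ne_two_zsmul_add_cm7_quadraticTwist_neg_one_rat ha',
    ha'⟩

end NegOne

end Summit.BirchSwinnertonDyer.BirchSwinnertonDyer.Theorems.GoldfeldGoodTwists

end
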